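import Summits.RiemannHypothesis.RiemannHypothesis.Theorems.GroundBartaEvenWinsBeyondArchDeflationPrimeY7
import Summits.RiemannHypothesis.RiemannHypothesis.Theorems.GroundBartaEvenWinsBeyondArchDeflationM83Common
import HarnessLib

/-!
# RiemannHypothesis / GroundBarta — parity ladder beyond `1` (`EvenWinsBeyondArch`, stmt-RiemannHypothesis-18085):
# shared kernel checks of the A-layer at the window `b = 1` (right end of parity cell 12, first `{2,3,4,5,7}`-window)

Helper file (`--supports stmt-RiemannHypothesis-18085`), RH-free, no named facts, no definitions.  Prover A (gen 23 of unit `sr-gb-rung-a`),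
after the per-cell `…Common` template (`…M83Common`, `…M94Common`, `…M97Common`).

The window `b = 1` is the right end of parity cell 12 `(9729/10000, 1]` (L-side: the format-C odd λ-run `WeilFormatCDataO100OddRung`,
`2⁻⁸⁸ ≤ ε_od(1)`) and the left end of cell 13; it is the first window of the five-prime-power regime `(log 7)/2 < 1 ≤ (log 8)/2`
(`m100_log7half_lt`, `m100_le_log8half`), prime powers `2, 3, 4, 5, 7` visible.  The pieces of the A-layer certificates that depend only
on the window: the two logarithmic inequalities, the five-prime-power prime check `m100_prime7Check` (`primeCheckY7` at scale `2¹¹⁰` with the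
window-independent `1/√2, 1/√3, 1/√5` brackets of `…M78Common` / `…M83Common` and a 31-digit `1/√7` bracket written out), and the order facts
`9729/10000 ≤ 1`.  The pole check lives in each final at its own scale (degree ≥ 64 needs `> 2⁵⁰⁰`), the killing-constant bracket in
`…DeflationFivePrimeWindow` (`dt_f7_weilMarkovConstant_sharp5`).
-/

set_option linter.dupNamespace false

noncomputable section

namespace Summit.RiemannHypothesis.RiemannHypothesis.Theorems.EvenWinsBeyondArch

open Literature.NumberTheory.LFunctions Finset

/-- `(log 7)/2 < 1` ((log 7)/2 = 0.97295507…). [folklore] -/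
theorem m100_log7half_lt : Real.log 7 / 2 < (((1 : ℚ)) : ℝ) := by
  have h := dt_e7_log7half_bracket.2
  push_cast
  linarith

/-- `1 ≤ (log 8)/2` (`e² = 7.389… ≤ 8`). [folklore] -/
theorem m100_le_log8half : (((1 : ℚ)) : ℝ) ≤ Real.log 8 / 2 := by
  have he : Real.exp 2 ≤ 8 := by
    have h1 := Real.exp_one_lt_d9
    have h0 := (Real.exp_pos 1).le
    have h2 : Real.exp 2 = Real.exp 1 * Real.exp 1 := by rw [← Real.exp_add]; norm_num
    rw [h2]
    nlinarith
  have : (2 : ℝ) ≤ Real.log 8 := (Real.le_log_iff_exp_le (by norm_num)).2 he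
  push_cast
  linarith

/-- `9729/10000 ≤ 1` as real casts of the rational windows (antitone transport of the cell-12 U-side). [folklore] -/
theorem m100_ge_9729 : (((9729 / 10000 : ℚ)) : ℝ) ≤ (((1 : ℚ)) : ℝ) := by
  push_cast; norm_num

/-- `0 < 1` for the rational window cast. [folklore] -/
theorem m100_pos : (0 : ℝ) < (((1 : ℚ)) : ℝ) := by
  push_cast; norm_num

set_option maxHeartbeats 0 in
/-- The five-prime-power prime check at scale `2¹¹⁰` (`K = 115`): the `log 2, log 3, log 5, log 7` enclosures succeed and the `1/√n` brackets
(`n = 2, 3, 5` shared, `1/√7 ∈ [0.3779644730092272272145165362341, …342]` written out) are valid. [folklore] -/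
theorem m100_prime7Check : primeCheckY7 (2 ^ 110) 115 m78_i2lo m78_i2hi m78_i3lo m78_i3hi m83_i5lo m83_i5hi
    (3779644730092272272145165362341 / 10000000000000000000000000000000) (1889822365046136136072582681171 / 5000000000000000000000000000000) = true := by
  decide +kernel

end Summit.RiemannHypothesis.RiemannHypothesis.Theorems.EvenWinsBeyondArch

end
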